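import Literature.NumberTheory.LFunctions.KloostermanFractionsFromC1
import Literature.NumberTheory.LFunctions.KloostermanFractionsRangeBookkeeping
import Literature.NumberTheory.LFunctions.KloostermanFractionsWeilBound
import HarnessLib

/-!
# Bilinear forms with Kloosterman fractions: DFI's Proposition from a generic second-moment bound

Topic `NumberTheory/LFunctions`.  W. Duke, J. Friedlander, H. Iwaniec, *Bilinear forms with
Kloosterman fractions*, Invent. Math. 128 (1997), Theorem 2 (in the form of the Proposition of
LMS Lecture Notes 237, p. 110: `DukeFriedlanderIwaniec1997_bilinearKloostermanFractions`), along
S. Bettin, V. Chandee, Adv. Math. 328 (2018), §§2, 7: `𝓑 ≪ ‖α‖ 𝓒₁^{1/2}` (2.1) and a bound for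
the amplified second moment `𝓒₁`.  The files `KloostermanFractionsFromC1.lean`,
`KloostermanFractionsFromBC71tau.lean` take the specific four-term bound (6.4) of Bettin–Chandee as
input.  This file PROVES the same implication for a GENERIC bound

  `𝓒₁ = ∑_{M<m≤2M} |∑_{(m,n)=1} β_n e(k m̄/n)|² ≤ K (1+|k|)^ε ‖β‖² (MN)^ε (1+|k|/MN)^{1/2} ∑_j M^{p_j}N^{q_j}`

(all `M, N ≥ 1/2`, `β` supported on `(N, 2N]` coprime to `k ≠ 0`), under explicit linear conditions
on the exponents (`DukeFriedlanderIwaniec1997_bilinearKloostermanFractions_of_generic_C1_bound`):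
each halved monomial `M^{p_j/2}N^{q_j/2}` must admit, on the range `N ≤ 4M^{4/3}`, a majorant
`(MN)^{a_j}(M+N)^{b_j}` (three ray conditions, `DFI_monomial_cover`) with `(a_j, b_j)` satisfying
the four conditions of `DFI_shape_of_generic_bound` (`KloostermanFractionsRangeBookkeeping.lean`)
with `θ = 1/4`.  The complementary range `N > 4M^{4/3}` needs NO second-moment input: there the
reciprocity swap (`DFI_bilinear_eq_swap`), the removal of the twist (`DFI_twisted_le_of_untwisted`)
and Duke–Friedlander–Iwaniec's Theorem 5 in the swapped box (`DFI_bilinear_weil_bound`) already give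
the DFI shape (`DFI_weil_cover`, `θ = 1/2`).  In particular the four monomials of (6.4)
(`MN^{3/4}, N^{7/4}, M^{6/5}N^{7/10}, M^{3/5}N^{13/10}`) qualify (with `(a,b) = (3/8,1/8), (3/8,5/16),
(17/48,1/4), (3/8,23/96)`), as do weaker families such as the one produced by the explicit
off-diagonal bound `kfO_le` of `KloostermanFractionsOffDiagO.lean` (e.g. `M^{3/4}N^{19/16}` with
`(3/8, 7/32)`).

## References

* W. Duke, J. Friedlander, H. Iwaniec, Invent. Math. 128 (1997) 23–43, Theorems 2 and 5.
  [DukeFriedlanderIwaniec1997]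
* S. Bettin, V. Chandee, Adv. Math. 328 (2018) 1234–1262 (arXiv:1502.00769), §2 (2.1), §7.
  [BettinChandee2018]
* W. Duke, J. Friedlander, H. Iwaniec, in: LMS Lecture Note Ser. 237 (1997), Proposition p. 110 and
  its proof p. 111. [DukeFriedlanderIwaniec1997Determinant]
-/

noncomputable section

open Finset Real Complex

namespace Literature.NumberTheory.LFunctions

/-! ### Square roots of sums -/

/-- `√(∑ x_j) ≤ ∑ √x_j` for `x_j ≥ 0`. [folklore] -/
theorem DFI_sqrt_sum_le {ι : Type*} (J : Finset ι) (x : ι → ℝ) (hx : ∀ j ∈ J, 0 ≤ x j) :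
    Real.sqrt (∑ j ∈ J, x j) ≤ ∑ j ∈ J, Real.sqrt (x j) := by
  classical
  induction J using Finset.induction_on with
  | empty => simp
  | insert i s hi ih =>
    rw [Finset.sum_insert hi, Finset.sum_insert hi]
    have hxi : 0 ≤ x i := hx i (Finset.mem_insert_self _ _)
    have hs : ∀ j ∈ s, 0 ≤ x j := fun j hj => hx j (Finset.mem_insert_of_mem hj)
    have hsum : 0 ≤ ∑ j ∈ s, x j := Finset.sum_nonneg hs
    -- `√(a + b) ≤ √a + √b`
    have hstep : Real.sqrt (x i + ∑ j ∈ s, x j) ≤ Real.sqrt (x i) + Real.sqrt (∑ j ∈ s, x j) := by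
      rw [Real.sqrt_le_left (by positivity)]
      have h1 : (Real.sqrt (x i) + Real.sqrt (∑ j ∈ s, x j)) ^ 2 =
          x i + ∑ j ∈ s, x j + 2 * (Real.sqrt (x i) * Real.sqrt (∑ j ∈ s, x j)) := by
        rw [add_sq, Real.sq_sqrt hxi, Real.sq_sqrt hsum]; ring
      rw [h1]
      have : 0 ≤ Real.sqrt (x i) * Real.sqrt (∑ j ∈ s, x j) := by positivity
      linarith
    exact hstep.trans (by linarith [ih hs])

/-- `√(∑_j M^{p_j} N^{q_j}) ≤ ∑_j M^{p_j/2} N^{q_j/2}`. [folklore] -/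
theorem DFI_sqrt_sum_monomials_le {ι : Type*} (J : Finset ι) (p q : ι → ℝ) {M N : ℝ}
    (hM : 0 < M) (hN : 0 < N) :
    Real.sqrt (∑ j ∈ J, M ^ (p j) * N ^ (q j)) ≤ ∑ j ∈ J, M ^ (p j / 2) * N ^ (q j / 2) := by
  refine (DFI_sqrt_sum_le J _ fun j _ => by positivity).trans (le_of_eq ?_)
  refine Finset.sum_congr rfl fun j _ => ?_
  rw [Real.sqrt_eq_rpow, Real.mul_rpow (by positivity) (by positivity),
    ← Real.rpow_mul hM.le, ← Real.rpow_mul hN.le]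
  ring_nf

/-! ### Cauchy–Schwarz for a generic second-moment bound -/

/-- **`𝓑 ≤ ‖α‖ 𝓒₁^{1/2}` for a generic family of monomials** (as
`DFI_bilinear_coprime_of_C1_bound`, with `∑_j M^{p_j}N^{q_j}` in place of the four terms of
(6.4)). [cite: BettinChandee2018, §2 (2.1), §7] -/
theorem DFI_bilinear_coprime_of_generic_C1 {ι : Type*} (J : Finset ι) (p q : ι → ℝ)
    {K ε M N : ℝ} (hK : 0 < K) (hM : 1 / 2 ≤ M)
    (hN : 1 / 2 ≤ N) {k : ℤ} {α β : ℕ → ℂ} (hα : ∀ m : ℕ, α m ≠ 0 → M < m ∧ (m : ℝ) ≤ 2 * M)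
    (hC : ∑ m ∈ Ioc ⌊M⌋₊ ⌊2 * M⌋₊, ‖∑ n ∈ Icc 1 ⌊2 * N⌋₊,
        (if m.Coprime n then
          β n * Complex.exp (2 * Real.pi * Complex.I *
            ((k : ℂ) * ((((m : ZMod n)⁻¹).val : ℕ) : ℂ) / (n : ℂ)))
        else 0)‖ ^ 2 ≤
      K * (1 + |(k : ℝ)|) ^ ε * (∑ n ∈ Icc 1 ⌊2 * N⌋₊, ‖β n‖ ^ 2) * (M * N) ^ ε *
        (1 + |(k : ℝ)| / (M * N)) ^ (1 / 2 : ℝ) * ∑ j ∈ J, M ^ (p j) * N ^ (q j)) :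
    ‖∑ m ∈ Icc 1 ⌊2 * M⌋₊, ∑ n ∈ Icc 1 ⌊2 * N⌋₊,
        if m.Coprime n then
          α m * β n * Complex.exp (2 * Real.pi * Complex.I *
            ((k : ℂ) * ((((m : ZMod n)⁻¹).val : ℕ) : ℂ) / (n : ℂ)))
        else 0‖ ≤
      Real.sqrt (∑ m ∈ Icc 1 ⌊2 * M⌋₊, ‖α m‖ ^ 2) *
        Real.sqrt (∑ n ∈ Icc 1 ⌊2 * N⌋₊, ‖β n‖ ^ 2) *
        (Real.sqrt K * (1 + |(k : ℝ)|) ^ (ε / 2) * (M * N) ^ (ε / 2) *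
          (1 + |(k : ℝ)| / (M * N)) ^ (1 / 4 : ℝ) *
          ∑ j ∈ J, M ^ (p j / 2) * N ^ (q j / 2)) := by
  have hM0 : 0 < M := by linarith
  have hN0 : 0 < N := by linarith
  have hQ0 : 0 < M * N := mul_pos hM0 hN0
  have hk0 : 0 ≤ 1 + |(k : ℝ)| := by positivity
  have h1 := DFI_bilinear_le_norm_mul_sqrt_C_Ioc M N k α β hα
  refine h1.trans ?_
  rw [mul_assoc (Real.sqrt (∑ m ∈ Icc 1 ⌊2 * M⌋₊, ‖α m‖ ^ 2))]
  refine mul_le_mul_of_nonneg_left ?_ (Real.sqrt_nonneg _)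
  refine (Real.sqrt_le_sqrt hC).trans ?_
  set nβ2 : ℝ := ∑ n ∈ Icc 1 ⌊2 * N⌋₊, ‖β n‖ ^ 2 with hnβ2
  have hnβ0 : 0 ≤ nβ2 := Finset.sum_nonneg fun _ _ => sq_nonneg _
  have hW0 : 0 ≤ 1 + |(k : ℝ)| / (M * N) := by positivity
  have hS0 : 0 ≤ ∑ j ∈ J, M ^ (p j) * N ^ (q j) := Finset.sum_nonneg fun _ _ => by positivity
  rw [Real.sqrt_mul' _ hS0, Real.sqrt_mul' _ (by positivity), Real.sqrt_mul' _ (by positivity),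
    Real.sqrt_mul' _ hnβ0, Real.sqrt_mul hK.le]
  have e0 : Real.sqrt ((1 + |(k : ℝ)|) ^ ε) = (1 + |(k : ℝ)|) ^ (ε / 2) := by
    rw [Real.sqrt_eq_rpow, ← Real.rpow_mul hk0]; ring_nf
  have e1 : Real.sqrt ((M * N) ^ ε) = (M * N) ^ (ε / 2) := by
    rw [Real.sqrt_eq_rpow, ← Real.rpow_mul hQ0.le]; ring_nf
  have e2 : Real.sqrt ((1 + |(k : ℝ)| / (M * N)) ^ (1 / 2 : ℝ)) =
      (1 + |(k : ℝ)| / (M * N)) ^ (1 / 4 : ℝ) := by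
    rw [Real.sqrt_eq_rpow, ← Real.rpow_mul hW0]; norm_num
  rw [e0, e1, e2]
  have h3 := DFI_sqrt_sum_monomials_le J p q hM0 hN0
  calc Real.sqrt K * (1 + |(k : ℝ)|) ^ (ε / 2) * Real.sqrt nβ2 * (M * N) ^ (ε / 2) *
        (1 + |(k : ℝ)| / (M * N)) ^ (1 / 4 : ℝ) * Real.sqrt (∑ j ∈ J, M ^ (p j) * N ^ (q j))
      ≤ Real.sqrt K * (1 + |(k : ℝ)|) ^ (ε / 2) * Real.sqrt nβ2 * (M * N) ^ (ε / 2) *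
        (1 + |(k : ℝ)| / (M * N)) ^ (1 / 4 : ℝ) * ∑ j ∈ J, M ^ (p j / 2) * N ^ (q j / 2) := by
        gcongr
    _ = _ := by ring

/-! ### The reduction to `β` coprime to `k`, all `M, N` -/

/-- **From a generic `𝓒₁` bound to a bilinear bound with `τ(|k|)^{1/2}`, all `M, N ≥ 1/2`**
(as `DFI_BC71tau_of_C1_bound`: Cauchy–Schwarz, then the reduction to `β` coprime to `k` of the
tree, `DFI_bilinear_bound_of_coprime_case`, with a clamped monotone majorant; here for a family
`∑_j M^{p_j}N^{q_j}` with `q_j ≥ 0` and without the restriction `N ≤ M`).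
[cite: BettinChandee2018, §§2, 7] -/
theorem DFI_generic_of_C1_bound {ι : Type*} (J : Finset ι) (p q : ι → ℝ)
    (hq : ∀ j ∈ J, 0 ≤ q j)
    (hC : ∀ ε : ℝ, 0 < ε → ∃ K : ℝ, 0 < K ∧
      ∀ (M N : ℝ), 1 / 2 ≤ M → 1 / 2 ≤ N → ∀ (k : ℤ), k ≠ 0 → ∀ (β : ℕ → ℂ),
        (∀ n : ℕ, β n ≠ 0 → N < n ∧ (n : ℝ) ≤ 2 * N) →
        (∀ n : ℕ, β n ≠ 0 → n.Coprime k.natAbs) →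
        ∑ m ∈ Ioc ⌊M⌋₊ ⌊2 * M⌋₊, ‖∑ n ∈ Icc 1 ⌊2 * N⌋₊,
            (if m.Coprime n then
              β n * Complex.exp (2 * Real.pi * Complex.I *
                ((k : ℂ) * ((((m : ZMod n)⁻¹).val : ℕ) : ℂ) / (n : ℂ)))
            else 0)‖ ^ 2 ≤
          K * (1 + |(k : ℝ)|) ^ ε * (∑ n ∈ Icc 1 ⌊2 * N⌋₊, ‖β n‖ ^ 2) * (M * N) ^ ε *
            (1 + |(k : ℝ)| / (M * N)) ^ (1 / 2 : ℝ) * ∑ j ∈ J, M ^ (p j) * N ^ (q j)) :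
    ∀ ε : ℝ, 0 < ε → ∃ K : ℝ, 0 < K ∧
      ∀ (M N : ℝ), 1 / 2 ≤ M → 1 / 2 ≤ N → ∀ (k : ℤ), k ≠ 0 → ∀ (α β : ℕ → ℂ),
        (∀ m : ℕ, α m ≠ 0 → M < m ∧ (m : ℝ) ≤ 2 * M) →
        (∀ n : ℕ, β n ≠ 0 → N < n ∧ (n : ℝ) ≤ 2 * N) →
        ‖∑ m ∈ Icc 1 ⌊2 * M⌋₊, ∑ n ∈ Icc 1 ⌊2 * N⌋₊,
            if m.Coprime n then
              α m * β n * Complex.exp (2 * Real.pi * Complex.I *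
                ((k : ℂ) * ((((m : ZMod n)⁻¹).val : ℕ) : ℂ) / (n : ℂ)))
            else 0‖ ≤
          K * Real.sqrt (k.natAbs.divisors.card : ℝ) * (1 + |(k : ℝ)|) ^ ε *
            Real.sqrt (∑ m ∈ Icc 1 ⌊2 * M⌋₊, ‖α m‖ ^ 2) *
            Real.sqrt (∑ n ∈ Icc 1 ⌊2 * N⌋₊, ‖β n‖ ^ 2) * (M * N) ^ ε *
            (1 + |(k : ℝ)| / (M * N)) ^ (1 / 4 : ℝ) *
            ∑ j ∈ J, M ^ (p j / 2) * N ^ (q j / 2) := by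
  intro ε hε
  obtain ⟨K, hK, hCK⟩ := hC (2 * ε) (by positivity)
  refine ⟨Real.sqrt K, by positivity, ?_⟩
  -- the bound function of the coprime case, clamped to be monotone in `N` on all of `ℝ`
  set S : ℝ → ℝ → ℝ := fun M' N' => ∑ j ∈ J, M' ^ (p j / 2) * N' ^ (q j / 2) with hS
  set G : ℝ → ℝ → ℤ → ℝ := fun M' N' k' =>
    Real.sqrt K * (1 + |(k' : ℝ)|) ^ (2 * ε / 2) * (max M' (1 / 2) * max N' (1 / 2)) ^ (2 * ε / 2) *
      (1 + |(k' : ℝ)| / (max M' (1 / 2) * max N' (1 / 2))) ^ (1 / 4 : ℝ) *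
      S (max M' (1 / 2)) (max N' (1 / 2)) with hG
  have hmaxpos : ∀ x : ℝ, 0 < max x (1 / 2) := fun x => lt_max_of_lt_right (by norm_num)
  have hSmono : ∀ M' : ℝ, 0 < M' → ∀ N₁ N₂ : ℝ, 0 < N₁ → N₁ ≤ N₂ → S M' N₁ ≤ S M' N₂ := by
    intro M' hM' N₁ N₂ hN₁ h12
    simp only [hS]
    refine Finset.sum_le_sum fun j hj => ?_
    have hqj : 0 ≤ q j / 2 := by have := hq j hj; positivity
    exact mul_le_mul_of_nonneg_left (Real.rpow_le_rpow hN₁.le h12 hqj) (by positivity)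
  have hS0 : ∀ M' N' : ℝ, 0 < M' → 0 < N' → 0 ≤ S M' N' := by
    intro M' N' hM' hN'; simp only [hS]
    exact Finset.sum_nonneg fun j _ => by positivity
  have hG0 : ∀ M' N' k', 0 ≤ G M' N' k' := by
    intro M' N' k'
    simp only [hG]
    have := hmaxpos M'; have := hmaxpos N'
    have := hS0 (max M' (1 / 2)) (max N' (1 / 2)) (hmaxpos M') (hmaxpos N')
    positivity
  have hGmono : ∀ (M' N' : ℝ) (k' : ℤ) (d : ℕ), 0 < d → (d : ℤ) ∣ k' →
      G M' (N' / d) (k' / d) ≤ G M' N' k' := by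
    intro M' N' k' d hd hdk
    have hd1 : (1 : ℝ) ≤ d := by exact_mod_cast hd
    have hd0 : (0 : ℝ) < d := by linarith
    set M₀ := max M' (1 / 2) with hM₀
    set N₁ := max (N' / d) (1 / 2) with hN₁
    set N₂ := max N' (1 / 2) with hN₂
    have hM₀0 : 0 < M₀ := hmaxpos M'
    have hN₁0 : 0 < N₁ := hmaxpos _
    have hN₂0 : 0 < N₂ := hmaxpos _
    have h12 : N₁ ≤ N₂ := by
      rcases le_or_gt 0 N' with h | h
      · exact max_le_max (div_le_self h hd1) le_rfl
      · have : N' / d < 1 / 2 := by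
          have : N' / d ≤ 0 := div_nonpos_of_nonpos_of_nonneg h.le (by positivity)
          linarith
        rw [hN₁, max_eq_right this.le]
        exact le_max_right _ _
    have h21 : N₂ ≤ d * N₁ := by
      refine max_le ?_ ?_
      · have : N' / d ≤ N₁ := le_max_left _ _
        calc N' = d * (N' / d) := by field_simp
          _ ≤ d * N₁ := by gcongr
      · have : (1 / 2 : ℝ) ≤ N₁ := le_max_right _ _
        nlinarith
    have hkd : |((k' / d : ℤ) : ℝ)| = |(k' : ℝ)| / d := by
      rw [Int.cast_div hdk (by exact_mod_cast hd.ne'), abs_div, Int.cast_natCast,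
        abs_of_pos hd0]
    have hfrac : |((k' / d : ℤ) : ℝ)| / (M₀ * N₁) ≤ |(k' : ℝ)| / (M₀ * N₂) := by
      rw [hkd, div_div, div_le_div_iff₀ (by positivity) (by positivity)]
      have hk0 : 0 ≤ |(k' : ℝ)| := abs_nonneg _
      calc |(k' : ℝ)| * (M₀ * N₂) ≤ |(k' : ℝ)| * (M₀ * (d * N₁)) := by gcongr
        _ = |(k' : ℝ)| * (d * (M₀ * N₁)) := by ring
    have hkabs : |((k' / d : ℤ) : ℝ)| ≤ |(k' : ℝ)| := by
      rw [hkd]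
      exact div_le_self (abs_nonneg _) hd1
    simp only [hG]
    rw [← hM₀, ← hN₁, ← hN₂]
    have hε0 : 0 ≤ 2 * ε / 2 := by positivity
    have hA : (1 + |((k' / d : ℤ) : ℝ)|) ^ (2 * ε / 2) ≤ (1 + |(k' : ℝ)|) ^ (2 * ε / 2) :=
      Real.rpow_le_rpow (by positivity) (by linarith) hε0
    have hB : (M₀ * N₁) ^ (2 * ε / 2) ≤ (M₀ * N₂) ^ (2 * ε / 2) :=
      Real.rpow_le_rpow (by positivity) (mul_le_mul_of_nonneg_left h12 hM₀0.le) hε0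
    have hC : (1 + |((k' / d : ℤ) : ℝ)| / (M₀ * N₁)) ^ (1 / 4 : ℝ) ≤
        (1 + |(k' : ℝ)| / (M₀ * N₂)) ^ (1 / 4 : ℝ) :=
      Real.rpow_le_rpow (by positivity) (by linarith) (by norm_num)
    have hD : S M₀ N₁ ≤ S M₀ N₂ := hSmono M₀ hM₀0 N₁ N₂ hN₁0 h12
    have hS1 : 0 ≤ S M₀ N₁ := hS0 _ _ hM₀0 hN₁0
    have hS2 : 0 ≤ S M₀ N₂ := hS0 _ _ hM₀0 hN₂0
    refine mul_le_mul (mul_le_mul (mul_le_mul (mul_le_mul_of_nonneg_left hA (Real.sqrt_nonneg _))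
      hB (by positivity) (by positivity)) hC (by positivity) (by positivity)) hD hS1 (by positivity)
  have hcore : ∀ (M' N' : ℝ), 1 / 2 ≤ M' → 1 / 2 ≤ N' → ∀ (k' : ℤ), k' ≠ 0 → ∀ (α' β' : ℕ → ℂ),
      (∀ m : ℕ, α' m ≠ 0 → M' < m ∧ (m : ℝ) ≤ 2 * M') →
      (∀ n : ℕ, β' n ≠ 0 → N' < n ∧ (n : ℝ) ≤ 2 * N') →
      (∀ n : ℕ, β' n ≠ 0 → n.Coprime k'.natAbs) →
      ‖∑ m ∈ Icc 1 ⌊2 * M'⌋₊, ∑ n ∈ Icc 1 ⌊2 * N'⌋₊,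
          if m.Coprime n then
            α' m * β' n * Complex.exp (2 * Real.pi * Complex.I *
              ((k' : ℂ) * ((((m : ZMod n)⁻¹).val : ℕ) : ℂ) / (n : ℂ)))
          else 0‖ ≤
        Real.sqrt (∑ m ∈ Icc 1 ⌊2 * M'⌋₊, ‖α' m‖ ^ 2) *
          Real.sqrt (∑ n ∈ Icc 1 ⌊2 * N'⌋₊, ‖β' n‖ ^ 2) * G M' N' k' := by
    intro M' N' hM' hN' k' hk' α' β' hα' hβ' hβ'k
    have h := DFI_bilinear_coprime_of_generic_C1 J p q hK hM' hN' hα'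
      (hCK M' N' hM' hN' k' hk' β' hβ' hβ'k)
    simpa only [hG, hS, max_eq_left hM', max_eq_left hN'] using h
  intro M N hM hN k hk α β hα hβ
  have hM0 : 0 < M := by linarith
  have hN0 : 0 < N := by linarith
  have h := DFI_bilinear_bound_of_coprime_case G hG0 hGmono hcore M N hM hN k hk α β hα hβ
  simp only [hG, hS, max_eq_left hM, max_eq_left hN] at h
  have hε2 : (2 * ε / 2 : ℝ) = ε := by ring
  rw [hε2] at h
  calc _ ≤ _ := h
    _ = _ := by ring


/-! ### Monomial covers -/

/-- **A monomial in the range `N ≤ 4M^{4/3}` in the shape `(MN)^a (M+N)^b`.**  If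
`P ≤ a + b`, `P + Q ≤ 2a + b`, `P + (4/3)Q ≤ (7/3)a + (4/3)b` (the three extreme rays `N ≍ 1`,
`N = M`, `N = M^{4/3}` of the range, in logarithmic coordinates), `0 ≤ a, b ≤ 1`, `0 ≤ P`,
`0 ≤ Q ≤ 2`, then `M^P N^Q ≤ 128 (MN)^a (M+N)^b` for `M, N ≥ 1/2`, `N ≤ 4M^{4/3}`. [folklore] -/
theorem DFI_monomial_cover {P Q a b M N : ℝ} (hM : 1 / 2 ≤ M) (hN : 1 / 2 ≤ N)
    (hNM : N ≤ 4 * M ^ (4 / 3 : ℝ)) (hP0 : 0 ≤ P) (hQ0 : 0 ≤ Q) (hQ2 : Q ≤ 2)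
    (ha0 : 0 ≤ a) (ha1 : a ≤ 1) (hb0 : 0 ≤ b) (hb1 : b ≤ 1)
    (c1 : P ≤ a + b) (c2 : P + Q ≤ 2 * a + b) (c3 : P + 4 / 3 * Q ≤ 7 / 3 * a + 4 / 3 * b) :
    M ^ P * N ^ Q ≤ 128 * ((M * N) ^ a * (M + N) ^ b) := by
  have hM0 : 0 < M := by linarith
  have hN0 : 0 < N := by linarith
  set ℓ : ℝ := Real.log 2 with hℓ
  have hℓ0 : 0 < ℓ := Real.log_pos (by norm_num)
  set m : ℝ := Real.log M with hm
  set n : ℝ := Real.log N with hn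
  have hm1 : -ℓ ≤ m := by
    have : Real.log (1 / 2) ≤ Real.log M := Real.log_le_log (by norm_num) hM
    rw [Real.log_div (by norm_num) (by norm_num), Real.log_one] at this
    linarith
  have hn1 : -ℓ ≤ n := by
    have : Real.log (1 / 2) ≤ Real.log N := Real.log_le_log (by norm_num) hN
    rw [Real.log_div (by norm_num) (by norm_num), Real.log_one] at this
    linarith
  have hu0 : 0 ≤ m + ℓ := by linarith
  have hv0 : 0 ≤ n + ℓ := by linarith
  -- the range in logarithmic coordinates: `n ≤ 2ℓ + (4/3) m`
  have hrange : n ≤ 2 * ℓ + 4 / 3 * m := by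
    have h1 : Real.log N ≤ Real.log (4 * M ^ (4 / 3 : ℝ)) := Real.log_le_log hN0 hNM
    rw [Real.log_mul (by norm_num) (by positivity), Real.log_rpow hM0,
      show (4 : ℝ) = 2 ^ 2 by norm_num, Real.log_pow] at h1
    push_cast at h1
    linarith
  -- `log (M + N)` dominates `m` and `n`
  have hP0' : 0 < M + N := by linarith
  have hmS : m ≤ Real.log (M + N) := Real.log_le_log hM0 (by linarith)
  have hnS : n ≤ Real.log (M + N) := Real.log_le_log hN0 (by linarith)
  -- constants
  have haℓ : a * ℓ ≤ ℓ := by nlinarith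
  have hbℓ : b * ℓ ≤ ℓ := by nlinarith
  have hPℓ : 0 ≤ P * ℓ := by positivity
  have hQℓ : 0 ≤ Q * ℓ := by positivity
  -- the key linear inequality
  have key : P * m + Q * n ≤ a * (m + n) + b * Real.log (M + N) + 7 * ℓ := by
    rcases le_or_gt n m with hnm | hmn
    · -- `n ≤ m`
      have hbm : b * m ≤ b * Real.log (M + N) := mul_le_mul_of_nonneg_left hmS hb0
      have step : P * m + Q * n ≤ a * (m + n) + b * m + 3 * ℓ := by
        by_cases haQ : a ≤ Q
        · have h1 : (Q - a) * (n + ℓ) ≤ (Q - a) * (m + ℓ) :=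
            mul_le_mul_of_nonneg_left (by linarith) (by linarith)
          have h2 : (P + Q - 2 * a - b) * (m + ℓ) ≤ 0 :=
            mul_nonpos_iff.mpr (Or.inr ⟨by linarith, hu0⟩)
          linarith
        · push Not at haQ
          have h1 : (Q - a) * (n + ℓ) ≤ 0 := mul_nonpos_iff.mpr (Or.inr ⟨by linarith, hv0⟩)
          have h2 : (P - a - b) * (m + ℓ) ≤ 0 := mul_nonpos_iff.mpr (Or.inr ⟨by linarith, hu0⟩)
          linarith
      linarith
    · -- `m < n ≤ 2ℓ + (4/3) m`
      have hbn : b * n ≤ b * Real.log (M + N) := mul_le_mul_of_nonneg_left hnS hb0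
      have hrange' : n + ℓ ≤ 4 / 3 * (m + ℓ) + 5 / 3 * ℓ := by linarith
      have step : P * m + Q * n ≤ a * (m + n) + b * n + 7 * ℓ := by
        by_cases hab : a + b ≤ Q
        · have h1 : (Q - a - b) * (n + ℓ) ≤ (Q - a - b) * (4 / 3 * (m + ℓ) + 5 / 3 * ℓ) :=
            mul_le_mul_of_nonneg_left hrange' (by linarith)
          have h2 : (P + 4 / 3 * Q - 7 / 3 * a - 4 / 3 * b) * (m + ℓ) ≤ 0 :=
            mul_nonpos_iff.mpr (Or.inr ⟨by linarith, hu0⟩)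
          have h3 : (Q - a - b) * ℓ ≤ 2 * ℓ := mul_le_mul_of_nonneg_right (by linarith) hℓ0.le
          linarith
        · push Not at hab
          have h1 : (Q - a - b) * (n + ℓ) ≤ (Q - a - b) * (m + ℓ) :=
            mul_le_mul_of_nonpos_left (by linarith) (by linarith)
          have h2 : (P + Q - 2 * a - b) * (m + ℓ) ≤ 0 :=
            mul_nonpos_iff.mpr (Or.inr ⟨by linarith, hu0⟩)
          linarith
      linarith
  -- exponentiate
  have e1 : M ^ P * N ^ Q = Real.exp (P * m + Q * n) := by
    rw [Real.rpow_def_of_pos hM0, Real.rpow_def_of_pos hN0, ← Real.exp_add, hm, hn]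
    ring_nf
  have e2 : (M * N) ^ a * (M + N) ^ b = Real.exp (a * (m + n) + b * Real.log (M + N)) := by
    rw [Real.rpow_def_of_pos (mul_pos hM0 hN0), Real.rpow_def_of_pos hP0', ← Real.exp_add,
      Real.log_mul hM0.ne' hN0.ne', hm, hn]
    ring_nf
  have e3 : Real.exp (7 * ℓ) = 128 := by
    rw [show (7 : ℝ) * ℓ = ((7 : ℕ) : ℝ) * ℓ by norm_num, Real.exp_nat_mul, hℓ,
      Real.exp_log (by norm_num)]
    norm_num
  rw [e1, e2, ← e3, ← Real.exp_add]
  exact Real.exp_le_exp.mpr (by linarith)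

/-- **The Weil monomials in the range `N > 4M^{4/3}`**: `√N + M ≤ (MN)^0 (M+N)^{1/2} +
(MN)^{3/8}(M+N)^{3/32}` (as `M^{5/8} ≤ N^{15/32}` there). [folklore] -/
theorem DFI_weil_cover {M N : ℝ} (hM : 1 / 2 ≤ M) (hN : 1 / 2 ≤ N)
    (hNM : 4 * M ^ (4 / 3 : ℝ) < N) :
    Real.sqrt N + M ≤ (M * N) ^ (0 : ℝ) * (M + N) ^ (1 / 2 : ℝ) +
      (M * N) ^ (3 / 8 : ℝ) * (M + N) ^ (3 / 32 : ℝ) := by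
  have hM0 : 0 < M := by linarith
  have hN0 : 0 < N := by linarith
  have h1 : Real.sqrt N ≤ (M * N) ^ (0 : ℝ) * (M + N) ^ (1 / 2 : ℝ) := by
    rw [Real.rpow_zero, one_mul, Real.sqrt_eq_rpow]
    exact Real.rpow_le_rpow hN0.le (by linarith) (by norm_num)
  have h43 : M ^ (4 / 3 : ℝ) ≤ N := by
    have : 0 ≤ M ^ (4 / 3 : ℝ) := by positivity
    linarith
  have h2 : M ^ (5 / 8 : ℝ) ≤ N ^ (15 / 32 : ℝ) := by
    have := Real.rpow_le_rpow (by positivity) h43 (by norm_num : (0 : ℝ) ≤ 15 / 32)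
    rw [← Real.rpow_mul hM0.le] at this
    norm_num at this
    exact this
  have h3 : M ≤ (M * N) ^ (3 / 8 : ℝ) * (M + N) ^ (3 / 32 : ℝ) := by
    have eM : M = M ^ (3 / 8 : ℝ) * M ^ (5 / 8 : ℝ) := by
      rw [← Real.rpow_add hM0]; norm_num
    have eN : N ^ (15 / 32 : ℝ) = N ^ (3 / 8 : ℝ) * N ^ (3 / 32 : ℝ) := by
      rw [← Real.rpow_add hN0]; norm_num
    have h4 : N ^ (3 / 32 : ℝ) ≤ (M + N) ^ (3 / 32 : ℝ) :=
      Real.rpow_le_rpow hN0.le (by linarith) (by norm_num)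
    calc M = M ^ (3 / 8 : ℝ) * M ^ (5 / 8 : ℝ) := eM
      _ ≤ M ^ (3 / 8 : ℝ) * N ^ (15 / 32 : ℝ) := mul_le_mul_of_nonneg_left h2 (by positivity)
      _ = M ^ (3 / 8 : ℝ) * N ^ (3 / 8 : ℝ) * N ^ (3 / 32 : ℝ) := by rw [eN]; ring
      _ = (M * N) ^ (3 / 8 : ℝ) * N ^ (3 / 32 : ℝ) := by rw [Real.mul_rpow hM0.le hN0.le]
      _ ≤ (M * N) ^ (3 / 8 : ℝ) * (M + N) ^ (3 / 32 : ℝ) :=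
          mul_le_mul_of_nonneg_left h4 (by positivity)
  linarith


/-! ### The main reduction: a generic `𝓒₁` bound implies the untwisted DFI shape -/

set_option maxHeartbeats 800000 in
/-- **A generic second-moment bound implies the DFI shape, all `M, N`.**  Suppose that for every
`ε > 0` there is `K` with, for all `M, N ≥ 1/2`, `k ≠ 0` and `β` supported on `N < n ≤ 2N`
coprime to `k`, `𝓒₁ = ∑_{M<m≤2M}|∑_{(m,n)=1} β_n e(k m̄/n)|² ≤ K (1+|k|)^ε ‖β‖² (MN)^ε
(1+|k|/MN)^{1/2} ∑_j M^{p_j} N^{q_j}` for a finite family of monomials whose halved exponents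
`(p_j/2, q_j/2)` admit, in the range `N ≤ 4M^{4/3}`, a majorant `(MN)^{a_j}(M+N)^{b_j}`
(`DFI_monomial_cover`) satisfying the four linear conditions of `DFI_shape_of_generic_bound` with
`θ = 1/4`.  Then `|𝓑(M,N)| ≪_ε ‖α‖‖β‖ (|k| + MN)^{3/8}(M+N)^{11/48+ε}` for all `M, N ≥ 1/2`:
in the range `N ≤ 4M^{4/3}` by Cauchy–Schwarz and the reduction to `β` coprime to `k`
(`DFI_generic_of_C1_bound`) followed by `DFI_shape_of_generic_bound` (`θ = 1/4`, `η = ε/8`); in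
the range `N > 4M^{4/3}` by the reciprocity swap (`DFI_bilinear_eq_swap`), the removal of the
twist (`DFI_twisted_le_of_untwisted`, cost `(1+|k|/MN)^{1/2}`) and the Weil-type bound of
Duke–Friedlander–Iwaniec's Theorem 5 in the swapped box (`DFI_bilinear_weil_bound`:
`≪ τ(|k|)^{1/2}(N^{1/2} + M)M^ε`), whose two monomials are `≤ (M+N)^{1/2} + (MN)^{3/8}(M+N)^{3/32}`
there (`DFI_weil_cover`), followed by `DFI_shape_of_generic_bound` (`θ = 1/2`).
[cite: BettinChandee2018, §§2, 7] [cite: DukeFriedlanderIwaniec1997, Theorems 2 and 5] -/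
theorem DFI_untwisted_allMN_of_generic_C1 {ι : Type*} (J : Finset ι) (p q aA bA : ι → ℝ)
    (hp0 : ∀ j ∈ J, 0 ≤ p j) (hq0 : ∀ j ∈ J, 0 ≤ q j) (hq4 : ∀ j ∈ J, q j ≤ 4)
    (ha0 : ∀ j ∈ J, 0 ≤ aA j) (ha1 : ∀ j ∈ J, aA j ≤ 1) (hb0 : ∀ j ∈ J, 0 ≤ bA j)
    (hb1 : ∀ j ∈ J, bA j ≤ 1)
    (c1 : ∀ j ∈ J, p j / 2 ≤ aA j + bA j) (c2 : ∀ j ∈ J, p j / 2 + q j / 2 ≤ 2 * aA j + bA j)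
    (c3 : ∀ j ∈ J, p j / 2 + 4 / 3 * (q j / 2) ≤ 7 / 3 * aA j + 4 / 3 * bA j)
    (s1 : ∀ j ∈ J, 2 * aA j + bA j ≤ 47 / 48) (s2 : ∀ j ∈ J, aA j + bA j ≤ 29 / 48)
    (s3 : ∀ j ∈ J, 11 / 6 * (aA j - 3 / 8) + bA j ≤ 11 / 48)
    (s4 : ∀ j ∈ J, 37 / 18 * (1 / 4 - 3 / 8 : ℝ) + 2 * (aA j - 1 / 4) + bA j ≤ 11 / 48)
    (hC : ∀ ε : ℝ, 0 < ε → ∃ K : ℝ, 0 < K ∧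
      ∀ (M N : ℝ), 1 / 2 ≤ M → 1 / 2 ≤ N → ∀ (k : ℤ), k ≠ 0 → ∀ (β : ℕ → ℂ),
        (∀ n : ℕ, β n ≠ 0 → N < n ∧ (n : ℝ) ≤ 2 * N) →
        (∀ n : ℕ, β n ≠ 0 → n.Coprime k.natAbs) →
        ∑ m ∈ Ioc ⌊M⌋₊ ⌊2 * M⌋₊, ‖∑ n ∈ Icc 1 ⌊2 * N⌋₊,
            (if m.Coprime n then
              β n * Complex.exp (2 * Real.pi * Complex.I *
                ((k : ℂ) * ((((m : ZMod n)⁻¹).val : ℕ) : ℂ) / (n : ℂ)))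
            else 0)‖ ^ 2 ≤
          K * (1 + |(k : ℝ)|) ^ ε * (∑ n ∈ Icc 1 ⌊2 * N⌋₊, ‖β n‖ ^ 2) * (M * N) ^ ε *
            (1 + |(k : ℝ)| / (M * N)) ^ (1 / 2 : ℝ) * ∑ j ∈ J, M ^ (p j) * N ^ (q j)) :
    ∀ ε : ℝ, 0 < ε → ∃ K : ℝ, 0 < K ∧
      ∀ (M N : ℝ), 1 / 2 ≤ M → 1 / 2 ≤ N → ∀ (k : ℤ), k ≠ 0 → ∀ (α β : ℕ → ℂ),
        (∀ m : ℕ, α m ≠ 0 → M < m ∧ (m : ℝ) ≤ 2 * M) →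
        (∀ n : ℕ, β n ≠ 0 → N < n ∧ (n : ℝ) ≤ 2 * N) →
        ‖∑ m ∈ Icc 1 ⌊2 * M⌋₊, ∑ n ∈ Icc 1 ⌊2 * N⌋₊,
            if m.Coprime n then
              α m * β n * Complex.exp (2 * Real.pi * Complex.I *
                ((k : ℂ) * ((((m : ZMod n)⁻¹).val : ℕ) : ℂ) / (n : ℂ)))
            else 0‖ ≤
          K * Real.sqrt (∑ m ∈ Icc 1 ⌊2 * M⌋₊, ‖α m‖ ^ 2) *
            Real.sqrt (∑ n ∈ Icc 1 ⌊2 * N⌋₊, ‖β n‖ ^ 2) *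
            (|(k : ℝ)| + M * N) ^ (3 / 8 : ℝ) * (M + N) ^ (11 / 48 + ε) := by
  intro ε hε
  obtain ⟨K, hK, hB⟩ := DFI_generic_of_C1_bound J p q hq0 hC (ε / 16) (by positivity)
  obtain ⟨Cτ, hCτ, hτ⟩ := DFI_sqrt_tau_le (η := ε / 16) (by positivity)
  obtain ⟨CW, hCW, hWeil⟩ := DFI_bilinear_weil_bound (ε := ε / 16) (by positivity)
  set KA : ℝ := K * Cτ * (2 : ℝ) ^ (ε / 16) * 128 with hKA
  have hKA0 : 0 < KA := by positivity
  set KB : ℝ := 2 * Real.exp (2 * π) * CW * Cτ * (2 : ℝ) ^ (ε / 16) with hKB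
  have hKB0 : 0 < KB := by positivity
  set Kf : ℝ := (2 + 4 * (2 : ℝ) ^ (1 / 4 : ℝ) * KA * J.card) +
    (2 + 4 * (2 : ℝ) ^ (1 / 2 : ℝ) * KB * 2) with hKf
  have hKfA : 0 ≤ 2 + 4 * (2 : ℝ) ^ (1 / 4 : ℝ) * KA * J.card := by positivity
  have hKfB : 0 ≤ 2 + 4 * (2 : ℝ) ^ (1 / 2 : ℝ) * KB * 2 := by positivity
  refine ⟨Kf, by positivity, ?_⟩
  intro M N hM hN k hk α β hα hβ
  have hM0 : 0 < M := by linarith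
  have hN0 : 0 < N := by linarith
  have hQ0 : 0 < M * N := mul_pos hM0 hN0
  have hR : (1 : ℝ) ≤ |(k : ℝ)| := by
    rw [← Int.cast_abs]; exact_mod_cast Int.one_le_abs hk
  have hR0 : (0 : ℝ) < |(k : ℝ)| := by linarith
  have htriv := DFI_bilinear_trivial_bound hM0.le hN0.le k α β
  set nα := Real.sqrt (∑ m ∈ Icc 1 ⌊2 * M⌋₊, ‖α m‖ ^ 2) with hnα
  set nβ := Real.sqrt (∑ n ∈ Icc 1 ⌊2 * N⌋₊, ‖β n‖ ^ 2) with hnβ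
  set B := ‖∑ m ∈ Icc 1 ⌊2 * M⌋₊, ∑ n ∈ Icc 1 ⌊2 * N⌋₊,
            if m.Coprime n then
              α m * β n * Complex.exp (2 * Real.pi * Complex.I *
                ((k : ℂ) * ((((m : ZMod n)⁻¹).val : ℕ) : ℂ) / (n : ℂ)))
            else 0‖ with hBdef
  have hnα0 : 0 ≤ nα := Real.sqrt_nonneg _
  have hnβ0 : 0 ≤ nβ := Real.sqrt_nonneg _
  have hF : 0 ≤ nα * nβ := mul_nonneg hnα0 hnβ0
  set G : ℝ := (|(k : ℝ)| + M * N) ^ (3 / 8 : ℝ) * (M + N) ^ (11 / 48 + ε) with hG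
  have hG0 : 0 ≤ G := by positivity
  -- the numerator factors
  set τk : ℝ := Real.sqrt (k.natAbs.divisors.card : ℝ) with hτk
  have hτk0 : 0 ≤ τk := Real.sqrt_nonneg _
  set Rη : ℝ := |(k : ℝ)| ^ (ε / 8) with hRη
  have hkk : |(k : ℝ)| ^ (ε / 16) * |(k : ℝ)| ^ (ε / 16) = Rη := by
    rw [hRη, ← Real.rpow_add hR0]; ring_nf
  have hτR : τk ≤ Cτ * Rη := by
    have h1 : τk ≤ Cτ * |(k : ℝ)| ^ (ε / 16) := hτ k hk
    have h2 : |(k : ℝ)| ^ (ε / 16) ≤ Rη := by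
      rw [hRη]; exact Real.rpow_le_rpow_of_exponent_le hR (by linarith)
    exact h1.trans (mul_le_mul_of_nonneg_left h2 hCτ.le)
  have hnum : τk * (1 + |(k : ℝ)|) ^ (ε / 16) ≤ Cτ * (2 : ℝ) ^ (ε / 16) * Rη := by
    have h1 : τk ≤ Cτ * |(k : ℝ)| ^ (ε / 16) := hτ k hk
    have h2 : (1 + |(k : ℝ)|) ^ (ε / 16) ≤ (2 : ℝ) ^ (ε / 16) * |(k : ℝ)| ^ (ε / 16) := by
      rw [← Real.mul_rpow (by norm_num) hR0.le]
      exact Real.rpow_le_rpow (by positivity) (by linarith) (by positivity)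
    calc τk * (1 + |(k : ℝ)|) ^ (ε / 16)
        ≤ (Cτ * |(k : ℝ)| ^ (ε / 16)) * ((2 : ℝ) ^ (ε / 16) * |(k : ℝ)| ^ (ε / 16)) := by
          gcongr
      _ = Cτ * (2 : ℝ) ^ (ε / 16) * (|(k : ℝ)| ^ (ε / 16) * |(k : ℝ)| ^ (ε / 16)) := by ring
      _ = Cτ * (2 : ℝ) ^ (ε / 16) * Rη := by rw [hkk]
  have htriv' : B ≤ 2 * Real.sqrt (M * N) * (nα * nβ) := by
    calc B ≤ _ := htriv
      _ = _ := by ring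
  -- it suffices to prove the bound with either of the two constants
  have hsuff : ∀ K₀ : ℝ, 0 ≤ Kf - K₀ → B ≤ K₀ * (nα * nβ) * G →
      B ≤ Kf * nα * nβ * (|(k : ℝ)| + M * N) ^ (3 / 8 : ℝ) * (M + N) ^ (11 / 48 + ε) := by
    intro K₀ hK₀ h
    have : 0 ≤ (Kf - K₀) * (nα * nβ) * G := by positivity
    calc B ≤ K₀ * (nα * nβ) * G := h
      _ ≤ K₀ * (nα * nβ) * G + (Kf - K₀) * (nα * nβ) * G := by linarith
      _ = Kf * nα * nβ * ((|(k : ℝ)| + M * N) ^ (3 / 8 : ℝ) * (M + N) ^ (11 / 48 + ε)) := by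
          rw [hG]; ring
      _ = _ := by ring
  by_cases hcase : N ≤ 4 * M ^ (4 / 3 : ℝ)
  · -- Range `N ≤ 4 M^{4/3}`: the generic family, `θ = 1/4`
    refine hsuff (2 + 4 * (2 : ℝ) ^ (1 / 4 : ℝ) * KA * J.card) (by rw [hKf]; linarith) ?_
    have h1 := hB M N hM hN k hk α β hα hβ
    have hcov : ∑ j ∈ J, M ^ (p j / 2) * N ^ (q j / 2) ≤
        128 * ∑ j ∈ J, (M * N) ^ (aA j) * (M + N) ^ (bA j) := by
      rw [Finset.mul_sum]
      refine Finset.sum_le_sum fun j hj => ?_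
      exact DFI_monomial_cover hM hN hcase (by have := hp0 j hj; positivity)
        (by have := hq0 j hj; positivity) (by have := hq4 j hj; linarith) (ha0 j hj) (ha1 j hj)
        (hb0 j hj) (hb1 j hj) (c1 j hj) (c2 j hj) (c3 j hj)
    have hfold : (M * N) ^ (ε / 16) * ∑ j ∈ J, (M * N) ^ (aA j) * (M + N) ^ (bA j) =
        ∑ j ∈ J, (M * N) ^ (aA j + ε / 16) * (M + N) ^ (bA j) := by
      rw [Finset.mul_sum]
      refine Finset.sum_congr rfl fun j _ => ?_
      rw [Real.rpow_add hQ0]; ring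
    have hbd : B ≤ KA * (nα * nβ) * Rη * (1 + |(k : ℝ)| / (M * N)) ^ (1 / 4 : ℝ) *
        ∑ j ∈ J, (M * N) ^ (aA j + ε / 16) * (M + N) ^ (bA j) := by
      have hS0 : 0 ≤ ∑ j ∈ J, M ^ (p j / 2) * N ^ (q j / 2) :=
        Finset.sum_nonneg fun j _ => by positivity
      calc B ≤ _ := h1
        _ = K * (τk * (1 + |(k : ℝ)|) ^ (ε / 16)) * (nα * nβ) *
            (1 + |(k : ℝ)| / (M * N)) ^ (1 / 4 : ℝ) *
            ((M * N) ^ (ε / 16) * ∑ j ∈ J, M ^ (p j / 2) * N ^ (q j / 2)) := by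
            rw [hτk]; ring
        _ ≤ K * (Cτ * (2 : ℝ) ^ (ε / 16) * Rη) * (nα * nβ) *
            (1 + |(k : ℝ)| / (M * N)) ^ (1 / 4 : ℝ) *
            ((M * N) ^ (ε / 16) * (128 * ∑ j ∈ J, (M * N) ^ (aA j) * (M + N) ^ (bA j))) := by
            gcongr
        _ = KA * (nα * nβ) * Rη * (1 + |(k : ℝ)| / (M * N)) ^ (1 / 4 : ℝ) *
            ((M * N) ^ (ε / 16) * ∑ j ∈ J, (M * N) ^ (aA j) * (M + N) ^ (bA j)) := by
            rw [hKA]; ring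
        _ = _ := by rw [hfold]
    have hmain := DFI_shape_of_generic_bound J (fun j => aA j + ε / 16) bA (θ := 1 / 4) (η := ε / 8)
      hε hKA0 hM hN hR hF (by norm_num) (by positivity)
      (fun i hi => by linarith [ha0 i hi])
      (fun i hi => by linarith [s1 i hi])
      (fun i hi => by linarith [s2 i hi])
      (fun i hi => by linarith [s3 i hi])
      (fun i hi => by linarith [s4 i hi])
      htriv' hbd
    calc B ≤ _ := hmain
      _ = _ := by rw [hG]; ring
  · -- Range `N > 4 M^{4/3}`: swap, untwist, Weil (`θ = 1/2`)
    push Not at hcase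
    refine hsuff (2 + 4 * (2 : ℝ) ^ (1 / 2 : ℝ) * KB * 2) (by rw [hKf]; linarith) ?_
    have hk' : (-k : ℤ) ≠ 0 := neg_ne_zero.mpr hk
    have habs : |((-k : ℤ) : ℝ)| = |(k : ℝ)| := by rw [Int.cast_neg, abs_neg]
    have hτ' : ((-k : ℤ)).natAbs = k.natAbs := Int.natAbs_neg k
    have hB' : ∀ (α' β' : ℕ → ℂ),
        (∀ m : ℕ, α' m ≠ 0 → N < m ∧ (m : ℝ) ≤ 2 * N) →
        (∀ n : ℕ, β' n ≠ 0 → M < n ∧ (n : ℝ) ≤ 2 * M) →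
        ‖∑ m ∈ Finset.Icc 1 ⌊2 * N⌋₊, ∑ n ∈ Finset.Icc 1 ⌊2 * M⌋₊,
            if Nat.Coprime m n then
              α' m * β' n * cexp (2 * π * I *
                (((-k : ℤ) : ℂ) * ((((m : ZMod n)⁻¹).val : ℕ) : ℂ) / (n : ℂ)))
            else 0‖ ≤
          CW * √(∑ m ∈ Finset.Icc 1 ⌊2 * N⌋₊, ‖α' m‖ ^ 2) *
            √(∑ n ∈ Finset.Icc 1 ⌊2 * M⌋₊, ‖β' n‖ ^ 2) *
            (τk * M ^ (ε / 16)) * (Real.sqrt N + M) := by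
      intro α' β' hα' hβ'
      have h2 := hWeil N M hN hM (-k) hk' α' β' hα' hβ'
      rw [hτ'] at h2
      calc _ ≤ _ := h2
        _ = _ := by rw [hτk]; ring
    have hP₁ : 0 ≤ τk * M ^ (ε / 16) := by positivity
    have hP₂ : 0 ≤ Real.sqrt N + M := by positivity
    have h3 := DFI_twisted_le_of_untwisted hN hM hCW.le hP₁ hP₂ hB' (k : ℝ) β α hβ hα
    have hW12 : (1 + |((k : ℝ))| / (N * M)) ^ (1 / 2 : ℝ) = (1 + |(k : ℝ)| / (M * N)) ^ (1 / 2 : ℝ) := by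
      rw [mul_comm N M]
    have hMε : M ^ (ε / 16) ≤ (2 : ℝ) ^ (ε / 16) * (M * N) ^ (ε / 16) := by
      rw [← Real.mul_rpow (by norm_num) hQ0.le]
      exact Real.rpow_le_rpow hM0.le (by nlinarith) (by positivity)
    have hwc := DFI_weil_cover hM hN hcase
    set a' : Fin 2 → ℝ := ![ε / 16, 3 / 8 + ε / 16] with ha'
    set b' : Fin 2 → ℝ := ![1 / 2, 3 / 32] with hb'
    have hsum2 : (M * N) ^ (ε / 16) * ((M * N) ^ (0 : ℝ) * (M + N) ^ (1 / 2 : ℝ) +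
        (M * N) ^ (3 / 8 : ℝ) * (M + N) ^ (3 / 32 : ℝ)) =
        ∑ i ∈ (Finset.univ : Finset (Fin 2)), (M * N) ^ (a' i) * (M + N) ^ (b' i) := by
      rw [Fin.sum_univ_two]
      simp only [ha', hb', Matrix.cons_val_zero, Matrix.cons_val_one]
      rw [Real.rpow_zero, one_mul, show 3 / 8 + ε / 16 = ε / 16 + 3 / 8 by ring,
        Real.rpow_add hQ0]
      ring
    have hbd : B ≤ KB * (nα * nβ) * Rη * (1 + |(k : ℝ)| / (M * N)) ^ (1 / 2 : ℝ) *
        ∑ i ∈ (Finset.univ : Finset (Fin 2)), (M * N) ^ (a' i) * (M + N) ^ (b' i) := by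
      rw [← hsum2, hBdef, DFI_bilinear_eq_swap]
      have hcov0 : 0 ≤ (M * N) ^ (0 : ℝ) * (M + N) ^ (1 / 2 : ℝ) +
          (M * N) ^ (3 / 8 : ℝ) * (M + N) ^ (3 / 32 : ℝ) := by positivity
      calc _ ≤ _ := h3
        _ = 2 * Real.exp (2 * π) * CW * (nα * nβ) * τk * M ^ (ε / 16) *
            (1 + |((k : ℝ))| / (N * M)) ^ (1 / 2 : ℝ) * (Real.sqrt N + M) := by
            rw [hnα, hnβ]; ring
        _ = 2 * Real.exp (2 * π) * CW * (nα * nβ) * τk * M ^ (ε / 16) *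
            (1 + |(k : ℝ)| / (M * N)) ^ (1 / 2 : ℝ) * (Real.sqrt N + M) := by rw [hW12]
        _ ≤ 2 * Real.exp (2 * π) * CW * (nα * nβ) * (Cτ * Rη) * ((2 : ℝ) ^ (ε / 16) * (M * N) ^ (ε / 16)) *
            (1 + |(k : ℝ)| / (M * N)) ^ (1 / 2 : ℝ) *
            ((M * N) ^ (0 : ℝ) * (M + N) ^ (1 / 2 : ℝ) + (M * N) ^ (3 / 8 : ℝ) * (M + N) ^ (3 / 32 : ℝ)) := by
            gcongr
        _ = KB * (nα * nβ) * Rη * (1 + |(k : ℝ)| / (M * N)) ^ (1 / 2 : ℝ) *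
            ((M * N) ^ (ε / 16) * ((M * N) ^ (0 : ℝ) * (M + N) ^ (1 / 2 : ℝ) +
              (M * N) ^ (3 / 8 : ℝ) * (M + N) ^ (3 / 32 : ℝ))) := by
            rw [hKB]; ring
    have hmain := DFI_shape_of_generic_bound (Finset.univ : Finset (Fin 2)) a' b'
      (θ := 1 / 2) (η := ε / 8) hε hKB0 hM hN hR hF (by norm_num) (by positivity)
      (fun i _ => by fin_cases i <;> simp [ha'] <;> positivity)
      (fun i _ => by fin_cases i <;> simp [ha', hb'] <;> linarith)
      (fun i _ => by fin_cases i <;> simp [ha', hb'] <;> linarith)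
      (fun i _ => by fin_cases i <;> simp [ha', hb'] <;> linarith)
      (fun i _ => by fin_cases i <;> simp [ha', hb'] <;> linarith)
      htriv' hbd
    have hcard : ((Finset.univ : Finset (Fin 2)).card : ℝ) = 2 := by simp
    calc B ≤ _ := hmain
      _ = _ := by rw [hG, hcard]; ring

/-- **The named fact from a generic `𝓒₁` bound.**  Under the hypotheses of
`DFI_untwisted_allMN_of_generic_C1`, `DukeFriedlanderIwaniec1997_bilinearKloostermanFractions`
holds (`DukeFriedlanderIwaniec1997_bilinearKloostermanFractions_of_untwisted`).
[cite: BettinChandee2018, §7] [cite: DukeFriedlanderIwaniec1997, Theorem 2] -/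
theorem DukeFriedlanderIwaniec1997_bilinearKloostermanFractions_of_generic_C1_bound
    {ι : Type*} (J : Finset ι) (p q aA bA : ι → ℝ)
    (hp0 : ∀ j ∈ J, 0 ≤ p j) (hq0 : ∀ j ∈ J, 0 ≤ q j) (hq4 : ∀ j ∈ J, q j ≤ 4)
    (ha0 : ∀ j ∈ J, 0 ≤ aA j) (ha1 : ∀ j ∈ J, aA j ≤ 1) (hb0 : ∀ j ∈ J, 0 ≤ bA j)
    (hb1 : ∀ j ∈ J, bA j ≤ 1)
    (c1 : ∀ j ∈ J, p j / 2 ≤ aA j + bA j) (c2 : ∀ j ∈ J, p j / 2 + q j / 2 ≤ 2 * aA j + bA j)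
    (c3 : ∀ j ∈ J, p j / 2 + 4 / 3 * (q j / 2) ≤ 7 / 3 * aA j + 4 / 3 * bA j)
    (s1 : ∀ j ∈ J, 2 * aA j + bA j ≤ 47 / 48) (s2 : ∀ j ∈ J, aA j + bA j ≤ 29 / 48)
    (s3 : ∀ j ∈ J, 11 / 6 * (aA j - 3 / 8) + bA j ≤ 11 / 48)
    (s4 : ∀ j ∈ J, 37 / 18 * (1 / 4 - 3 / 8 : ℝ) + 2 * (aA j - 1 / 4) + bA j ≤ 11 / 48)
    (hC : ∀ ε : ℝ, 0 < ε → ∃ K : ℝ, 0 < K ∧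
      ∀ (M N : ℝ), 1 / 2 ≤ M → 1 / 2 ≤ N → ∀ (k : ℤ), k ≠ 0 → ∀ (β : ℕ → ℂ),
        (∀ n : ℕ, β n ≠ 0 → N < n ∧ (n : ℝ) ≤ 2 * N) →
        (∀ n : ℕ, β n ≠ 0 → n.Coprime k.natAbs) →
        ∑ m ∈ Ioc ⌊M⌋₊ ⌊2 * M⌋₊, ‖∑ n ∈ Icc 1 ⌊2 * N⌋₊,
            (if m.Coprime n then
              β n * Complex.exp (2 * Real.pi * Complex.I *
                ((k : ℂ) * ((((m : ZMod n)⁻¹).val : ℕ) : ℂ) / (n : ℂ)))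
            else 0)‖ ^ 2 ≤
          K * (1 + |(k : ℝ)|) ^ ε * (∑ n ∈ Icc 1 ⌊2 * N⌋₊, ‖β n‖ ^ 2) * (M * N) ^ ε *
            (1 + |(k : ℝ)| / (M * N)) ^ (1 / 2 : ℝ) * ∑ j ∈ J, M ^ (p j) * N ^ (q j)) :
    DukeFriedlanderIwaniec1997_bilinearKloostermanFractions :=
  DukeFriedlanderIwaniec1997_bilinearKloostermanFractions_of_untwisted
    (DFI_untwisted_allMN_of_generic_C1 J p q aA bA hp0 hq0 hq4 ha0 ha1 hb0 hb1 c1 c2 c3 s1 s2 s3 s4 hC)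

end Literature.NumberTheory.LFunctions

end
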